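import Summits.CriticalPhenomena.PercolationContinuityZ3.Theorems.SahiIsingThreeSites
import Literature.Probability.LatticeModels.IsingFieldModel

/-!
# The Ising model with a site-dependent field: the finite-volume Gibbs measures are box-TP₂

Support file of the Sahi cell (`prim-sahi`, typer seat, generation 13; `--supports stmt-CriticalPhenomena-4575`).
Theorems only (no definitions, no named facts, no sorries).  The inhomogeneous-field twin of `isBoxTP2_isingMeasure`
(`SahiIsingBoxTP2.lean`): the tree's `fieldIsingMeasure G Λ β h bc` (`IsingFieldModel`: Hamiltonian
`−∑_{xy} σ_xσ_y − ∑_x h_x σ_x`, ANY field `h : V → ℝ`, any boundary condition, `β ≥ 0`) is box-TP₂ on the INFINITE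
configuration space `{−1,+1}^V` (`isBoxTP2_fieldIsingMeasure`: four functions theorem with the lattice condition
`fieldWeight_lattice_condition` on the glued preimages of two boxes; the mass of a measurable set is the
Boltzmann-weighted count of the glued configurations, `fieldIsingMeasure_real_eq_sum_div`, from `fieldExpect_eq_sum_div`).
Consequently every theorem of the generation-13 series for box-TP₂ spin laws applies verbatim to the
inhomogeneous-field measures and their local limits: recorded here are, for `V` countably infinite (e.g. a finite
volume of `ℤ^d` inside the full configuration space) — given `C_n`, Sahi positivity for ALL measurable monotone
functionals (`fieldIsingMeasure_msahiE_nonneg(_antitone/_of_sahiConjecture)`), and UNCONDITIONALLY: FKG for all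
measurable monotone functionals (`fieldIsingMeasure_integral_mul_integral_le`), two free local slots
(`fieldIsingMeasure_msahiE_nonneg_plusSpins_offTwo`), three spins at every order
(`fieldIsingMeasure_msahiE_threeSites_nonneg`); and thermodynamic limits with site-dependent fields are box-TP₂
(`isBoxTP2_of_tendsto_fieldIsingMeasure`).

No sorries, no new axioms.
-/

noncomputable section

namespace Summit.CriticalPhenomena.PercolationContinuityZ3.Theorems.SahiBoxTP2

open MeasureTheory ProbabilityTheory Set Filter Topology Function Literature.Combinatorics.Sahi2008
open Literature.Probability.LatticeModels
open scoped ENNReal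

section Field

variable {V : Type*} (G : SimpleGraph V) [DecidableEq V] [G.LocallyFinite]

/-- **The mass of a measurable set under the site-dependent-field Gibbs measure** is the Boltzmann-weighted count of
the glued configurations it contains, `μ(T) = (∑_{τ : glue τ ∈ T} w(τ)) / Z` (real form). [folklore] -/
theorem fieldIsingMeasure_real_eq_sum_div (Λ : Finset V) (β : ℝ) (h : V → ℝ) (bc : BoundaryCondition V)
    {T : Set (SpinConfig V)} (hT : MeasurableSet T) [DecidablePred (· ∈ T)] :
    (fieldIsingMeasure G Λ β h bc).real T =
      (∑ τ : Λ → ℤˣ with glue Λ τ bc ∈ T, fieldWeight G Λ β h bc τ) / fieldZ G Λ β h bc := by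
  classical
  have hm : Measurable (T.indicator (1 : SpinConfig V → ℝ)) := measurable_const.indicator hT
  rw [← integral_indicator_one hT, ← fieldExpect, fieldExpect_eq_sum_div G Λ β h bc hm, Finset.sum_filter]
  congr 1
  refine Finset.sum_congr rfl fun τ _ => ?_
  by_cases hτ : glue Λ τ bc ∈ T
  · rw [indicator_of_mem hτ, Pi.one_apply, mul_one, if_pos hτ]
  · rw [indicator_of_notMem hτ, mul_zero, if_neg hτ]

open scoped FinsetFamily in
/-- **The finite-volume Ising measure with a site-dependent field is box-TP₂ on `{−1,+1}^V`** (`β ≥ 0`, ANY field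
`h : V → ℝ`, any boundary condition, any countable locally finite graph): for all order boxes,
`μ[a,b] μ[a',b'] ≤ μ[a ∧ a', b ∧ b'] μ[a ∨ a', b ∨ b']` (four functions theorem with `fieldWeight_lattice_condition` on
the glued preimages, `glue_inf`, `glue_sup`). [this work] -/
theorem isBoxTP2_fieldIsingMeasure [Countable V] (Λ : Finset V) {β : ℝ} (hβ : 0 ≤ β) (h : V → ℝ)
    (bc : BoundaryCondition V) : IsBoxTP2 (fieldIsingMeasure G Λ β h bc) := by
  classical
  intro a b a' b'
  set w : (Λ → ℤˣ) → ℝ := fieldWeight G Λ β h bc with hw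
  set Z : ℝ := fieldZ G Λ β h bc with hZ
  have hZpos : 0 < Z := fieldZ_pos G Λ β h bc
  have hw0 : 0 ≤ w := fun τ => (fieldWeight_pos G Λ β h bc τ).le
  set S : (V → ℤˣ) → (V → ℤˣ) → Finset (Λ → ℤˣ) :=
    fun p q => Finset.univ.filter fun τ => glue Λ τ bc ∈ Icc p q with hS
  have hreal : ∀ p q : V → ℤˣ, fieldIsingMeasure G Λ β h bc (Icc p q) = ENNReal.ofReal ((∑ τ ∈ S p q, w τ) / Z) :=
    fun p q => by
      rw [← ofReal_measureReal (measure_ne_top _ _),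
        fieldIsingMeasure_real_eq_sum_div G Λ β h bc (measurableSet_Icc_spinConfig p q)]
  have hsum0 : ∀ p q : V → ℤˣ, 0 ≤ (∑ τ ∈ S p q, w τ) / Z := fun p q =>
    div_nonneg (Finset.sum_nonneg fun τ _ => hw0 τ) hZpos.le
  rw [hreal, hreal, hreal, hreal, ← ENNReal.ofReal_mul (hsum0 _ _), ← ENNReal.ofReal_mul (hsum0 _ _)]
  refine ENNReal.ofReal_le_ofReal ?_
  rw [div_mul_div_comm, div_mul_div_comm]
  refine div_le_div_of_nonneg_right ?_ (mul_pos hZpos hZpos).le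
  have h4 := four_functions_theorem w w w w hw0 hw0 hw0 hw0
    (fun τ τ' => fieldWeight_lattice_condition G Λ hβ h bc τ τ') (S a b) (S a' b')
  have hinfs : S a b ⊼ S a' b' ⊆ S (a ⊓ a') (b ⊓ b') := by
    intro c hc
    rw [Finset.mem_infs] at hc
    obtain ⟨τ, hτ, τ', hτ', rfl⟩ := hc
    simp only [hS, Finset.mem_filter, Finset.mem_univ, true_and, mem_Icc] at hτ hτ' ⊢
    rw [glue_inf]
    exact ⟨le_inf (inf_le_left.trans hτ.1) (inf_le_right.trans hτ'.1), inf_le_inf hτ.2 hτ'.2⟩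
  have hsups : S a b ⊻ S a' b' ⊆ S (a ⊔ a') (b ⊔ b') := by
    intro c hc
    rw [Finset.mem_sups] at hc
    obtain ⟨τ, hτ, τ', hτ', rfl⟩ := hc
    simp only [hS, Finset.mem_filter, Finset.mem_univ, true_and, mem_Icc] at hτ hτ' ⊢
    rw [glue_sup]
    exact ⟨sup_le_sup hτ.1 hτ'.1, sup_le (hτ.2.trans le_sup_left) (hτ'.2.trans le_sup_right)⟩
  calc (∑ τ ∈ S a b, w τ) * ∑ τ ∈ S a' b', w τ
      ≤ (∑ τ ∈ S a b ⊼ S a' b', w τ) * ∑ τ ∈ S a b ⊻ S a' b', w τ := h4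
    _ ≤ (∑ τ ∈ S (a ⊓ a') (b ⊓ b'), w τ) * ∑ τ ∈ S (a ⊔ a') (b ⊔ b'), w τ :=
        mul_le_mul (Finset.sum_le_sum_of_subset_of_nonneg hinfs fun τ _ _ => hw0 τ)
          (Finset.sum_le_sum_of_subset_of_nonneg hsups fun τ _ _ => hw0 τ)
          (Finset.sum_nonneg fun τ _ => hw0 τ) (Finset.sum_nonneg fun τ _ => hw0 τ)

/-- **Thermodynamic limits of site-dependent-field Ising measures are box-TP₂** (any volumes, any fields `h_L`, any
boundary conditions, `β ≥ 0`; convergence on measurable local events). [this work] -/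
theorem isBoxTP2_of_tendsto_fieldIsingMeasure [Countable V] (Λs : ℕ → Finset V) (hs : ℕ → V → ℝ)
    (bcs : ℕ → BoundaryCondition V) {β : ℝ} (hβ : 0 ≤ β) (μ : Measure (V → ℤˣ)) [IsFiniteMeasure μ]
    (hconv : ∀ (J : Finset V) (C : Set (V → ℤˣ)), MeasurableSet C → DependsOn (fun σ => σ ∈ C) (↑J : Set V) →
      Tendsto (fun L => fieldIsingMeasure G (Λs L) β (hs L) (bcs L) C) atTop (𝓝 (μ C))) :
    IsBoxTP2 μ :=
  isBoxTP2_of_tendsto_local (fun L => fieldIsingMeasure G (Λs L) β (hs L) (bcs L)) μ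
    (fun L => isBoxTP2_fieldIsingMeasure G (Λs L) hβ (hs L) (bcs L)) hconv

variable {n : ℕ}

/-- **Given `C_n` (⟸ `∀ d, LiebSahiContinuum d n`): the finite-volume Ising measure with a site-dependent field
(`β ≥ 0`, any `h`, any `bc`, `V` countably infinite) satisfies `E_n(f_0,…,f_{n−1}) ≥ 0` for ALL measurable nonnegative
increasing functionals of the whole configuration.** [this work] -/
theorem fieldIsingMeasure_msahiE_nonneg [Countable V] [Infinite V] (hL : ∀ d, LiebSahiContinuum d n) (Λ : Finset V)
    {β : ℝ} (hβ : 0 ≤ β) (h : V → ℝ) (bc : BoundaryCondition V) (f : Fin n → SpinConfig V → ℝ)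
    (hfm : ∀ i, Measurable (f i)) (hf0 : ∀ i σ, 0 ≤ f i σ) (hmono : ∀ i, Monotone (f i)) :
    0 ≤ msahiE (fieldIsingMeasure G Λ β h bc) n f :=
  msahiE_nonneg_of_isBoxTP2_spinConfig hL _ (isBoxTP2_fieldIsingMeasure G Λ hβ h bc) f hfm hf0 hmono

/-- Decreasing functionals. [this work] -/
theorem fieldIsingMeasure_msahiE_nonneg_antitone [Countable V] [Infinite V] (hL : ∀ d, LiebSahiContinuum d n)
    (Λ : Finset V) {β : ℝ} (hβ : 0 ≤ β) (h : V → ℝ) (bc : BoundaryCondition V) (f : Fin n → SpinConfig V → ℝ)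
    (hfm : ∀ i, Measurable (f i)) (hf0 : ∀ i σ, 0 ≤ f i σ) (hanti : ∀ i, Antitone (f i)) :
    0 ≤ msahiE (fieldIsingMeasure G Λ β h bc) n f :=
  msahiE_nonneg_of_isBoxTP2_spinConfig_antitone hL _ (isBoxTP2_fieldIsingMeasure G Λ hβ h bc) f hfm hf0 hanti

/-- From `C_n`. [this work; cite: Sahi2008, Conj. 5 (p. 212); LiebSahi2021, Conj. 1.1] -/
theorem fieldIsingMeasure_msahiE_nonneg_of_sahiConjecture [Countable V] [Infinite V] (hC : SahiConjecture n)
    (Λ : Finset V) {β : ℝ} (hβ : 0 ≤ β) (h : V → ℝ) (bc : BoundaryCondition V) (f : Fin n → SpinConfig V → ℝ)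
    (hfm : ∀ i, Measurable (f i)) (hf0 : ∀ i σ, 0 ≤ f i σ) (hmono : ∀ i, Monotone (f i)) :
    0 ≤ msahiE (fieldIsingMeasure G Λ β h bc) n f :=
  fieldIsingMeasure_msahiE_nonneg G ((sahiConjecture_iff_forall_liebSahiContinuum n).1 hC) Λ hβ h bc f hfm hf0 hmono

/-- **UNCONDITIONALLY: FKG for all measurable nonnegative increasing functionals of the whole configuration** under the
site-dependent-field Ising measure (`V` countably infinite; the tree's `field_fkg` is the same for the finite-sum
expectation functional). [this work] -/
theorem fieldIsingMeasure_integral_mul_integral_le [Countable V] [Infinite V] (Λ : Finset V) {β : ℝ} (hβ : 0 ≤ β)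
    (h : V → ℝ) (bc : BoundaryCondition V) {f g : SpinConfig V → ℝ} (hfm : Measurable f) (hgm : Measurable g)
    (hf0 : ∀ σ, 0 ≤ f σ) (hg0 : ∀ σ, 0 ≤ g σ) (hf : Monotone f) (hg : Monotone g) :
    (∫ σ, f σ ∂fieldIsingMeasure G Λ β h bc) * (∫ σ, g σ ∂fieldIsingMeasure G Λ β h bc) ≤
      ∫ σ, f σ * g σ ∂fieldIsingMeasure G Λ β h bc :=
  integral_mul_integral_le_of_isBoxTP2_spinConfig _ (isBoxTP2_fieldIsingMeasure G Λ hβ h bc) hfm hgm hf0 hg0 hf hg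

/-- **UNCONDITIONALLY: Sahi's Theorem 2 with two free local slots** under the site-dependent-field Ising measure,
every `n` (`V` countable). [this work] -/
theorem fieldIsingMeasure_msahiE_nonneg_plusSpins_offTwo [Countable V] (Λ : Finset V) {β : ℝ} (hβ : 0 ≤ β)
    (h : V → ℝ) (bc : BoundaryCondition V) (J : Finset V) (f : Fin n → SpinConfig V → ℝ)
    (hdep : ∀ i, DependsOn (f i) (↑J : Set V)) (hf0 : ∀ i σ, 0 ≤ f i σ) (hmono : ∀ i, Monotone (f i))
    (I : Finset (Fin n)) (hI : I.card ≤ 2) (A : Fin n → Finset V)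
    (hcum : ∀ i, i ∉ I → f i = {σ : SpinConfig V | ∀ v ∈ A i, σ v = 1}.indicator 1) :
    0 ≤ msahiE (fieldIsingMeasure G Λ β h bc) n f :=
  msahiE_nonneg_offTwo_of_isBoxTP2_local _ (isBoxTP2_fieldIsingMeasure G Λ hβ h bc) J f hdep hf0 hmono I hI A hcum

/-- **UNCONDITIONALLY, EVERY ORDER: functions of three spins** under the site-dependent-field Ising measure
(`V` countable). [this work] -/
theorem fieldIsingMeasure_msahiE_threeSites_nonneg [Countable V] (Λ : Finset V) {β : ℝ} (hβ : 0 ≤ β) (h : V → ℝ)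
    (bc : BoundaryCondition V) (v : Fin 3 → V) (g : Fin n → (Fin 3 → ℤˣ) → ℝ) (hg0 : ∀ i y, 0 ≤ g i y)
    (hmono : ∀ i, Monotone (g i)) : 0 ≤ msahiE (fieldIsingMeasure G Λ β h bc) n fun i σ => g i fun a => σ (v a) :=
  msahiE_threeSites_nonneg_of_isBoxTP2 _ (isBoxTP2_fieldIsingMeasure G Λ hβ h bc) v g hg0 hmono

end Field

end Summit.CriticalPhenomena.PercolationContinuityZ3.Theorems.SahiBoxTP2
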